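import Summits.CriticalPhenomena.PercolationContinuityZ3.Theorems.PercNearOneGluingNoHeavyLowerTailKnQuestion8CoefficientwiseNoCoreBase
import HarnessLib

/-!
# The in-gadget cell lemma: freezing the blue cluster of `q` — prim-lf-2 gen 56

Support file (`--supports stmt-CriticalPhenomena-4575`, closed), prover `prim-lf-2` (gen 56).  No definitions, no named facts, no sorries; standard axioms.
Memo `prim-lf-2/CW-DELCON-gen56.md` §8; companions `…CoefficientwiseStrata.lean` (`noCore_of_strata`), `…CoefficientwiseTopStratum.lean`.

Setting: multigraph `ends : ι → Sym2 V`, edge set `E`, root `x`, target `y`, colourings `s ⊆ E` (red) / `E ∖ s` (blue), `C_a(s) = openCluster (ends '' s) a`,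
`T(s) = (f(C_x s) − f(C_x(E∖s)))(g(C_x s) − g(C_x(E∖s)))`.
THE IN-GADGET INEQUALITY (IG) for the pair `(f,g)`, a free edge set `E_f`, a gadget `B` (disjoint edge sets) and a vertex set `S' ∋ x`, `y ∉ S'`, no free edge at `y`:
  `0 ≤ Σ_{r ⊆ E_f : ∃ a ∈ S', y ∈ C_a(r ∪ B)} (f(C_x(r ∪ B)) − f(C_x(E_f ∖ r)))·(g(C_x(r ∪ B)) − g(C_x(E_f ∖ r)))`
(prim-lf-2 gen 56: census-clean for ALL monotone pairs on every instance with ≤ 5 vertices (317 492) and 192 000 random instances on 6 vertices; the proven off-cluster lemma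
`offCluster_twoColouring_nonneg_gen` is the same two-function sum with an AVOIDANCE event on the plain side — here the event sits on the gadget side).
* `Coefficientwise.inGadget_cell_nonneg` — **CELL LEMMA.**  Assume (IG) (for the given `f, g, x, y`, all `E_f, B ⊆ E` and the given `S'`).  Then for any `S ∋ x` and any vertex `q`,
  `0 ≤ Σ_{s ⊆ E : y ∈ C_q(E∖s), S ∩ C_q(E∖s) = ∅, ∃ a ∈ S', y ∈ C_a(s)} T(s)`:
  freeze the blue cluster `W = C_q(E∖s)` of `q` together with the colours of the edges `I(W)` touching it (the boundary ones are red); on such a cell the free edges `E ∖ I(W)` are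
  unconstrained, the red cluster of `x` is `C_x(r ∪ π)` with the red GADGET `π = s ∩ I(W)`, the blue cluster of `x ∉ W` never touches `I(W)`, and no free edge meets `y ∈ W` — an
  instance of (IG).  (Used twice by `…CoefficientwiseInGadget.lean`: every stratum of the root-set stratification is a sum of two such cell sums.)
[cite: KozmaNitzan2024, Questions 8–9 (§5.5 p. 36) (context: the Question-8 pocket covariance programme)]
-/

namespace Summit.CriticalPhenomena.PercolationContinuityZ3.Theorems

open Finset Literature.Probability.Percolation

namespace Coefficientwise

variable {ι V : Type*} [DecidableEq ι]

open Classical in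
/-- **In-gadget cell lemma** (see the module docstring).  [cite: KozmaNitzan2024, Questions 8–9 (§5.5 p. 36) (context)] -/
theorem inGadget_cell_nonneg (ends : ι → Sym2 V) (E : Finset ι) (x y q : V) (S S' : Finset V) (hxS : x ∈ S)
    (f g : Set V → ℝ)
    (hIG : ∀ (Ef Bg : Finset ι), Ef ⊆ E → Bg ⊆ E → Disjoint Ef Bg → (∀ i ∈ Ef, y ∉ ends i) →
      0 ≤ ∑ r ∈ Ef.powerset.filter (fun r : Finset ι => ∃ a ∈ S', y ∈ openCluster (ends '' (↑(r ∪ Bg) : Set ι)) a),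
        (f (openCluster (ends '' (↑(r ∪ Bg) : Set ι)) x) - f (openCluster (ends '' (↑(Ef \ r) : Set ι)) x)) *
          (g (openCluster (ends '' (↑(r ∪ Bg) : Set ι)) x) - g (openCluster (ends '' (↑(Ef \ r) : Set ι)) x))) :
    0 ≤ ∑ s ∈ E.powerset.filter (fun s : Finset ι =>
          (y ∈ openCluster (ends '' (↑(E \ s) : Set ι)) q ∧ ∀ a ∈ S, a ∉ openCluster (ends '' (↑(E \ s) : Set ι)) q) ∧
            ∃ a ∈ S', y ∈ openCluster (ends '' (↑s : Set ι)) a),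
      (f (openCluster (ends '' (↑s : Set ι)) x) - f (openCluster (ends '' (↑(E \ s) : Set ι)) x)) *
        (g (openCluster (ends '' (↑s : Set ι)) x) - g (openCluster (ends '' (↑(E \ s) : Set ι)) x)) := by
  -- notation
  set K : Finset ι → Set V := fun s => openCluster (ends '' (↑s : Set ι)) x with hK
  set T : Finset ι → ℝ := fun s => (f (K s) - f (K (E \ s))) * (g (K s) - g (K (E \ s))) with hT
  set Q : Finset ι → Set V := fun s => openCluster (ends '' (↑(E \ s) : Set ι)) q with hQ
  set I : Set V → Finset ι := fun W => E.filter (fun i : ι => ∃ v ∈ W, v ∈ ends i) with hI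
  set key : Finset ι → Set V × Finset ι := fun s => (Q s, s ∩ I (Q s)) with hkey
  set P : Finset ι → Prop := fun s => (y ∈ Q s ∧ ∀ a ∈ S, a ∉ Q s) ∧ ∃ a ∈ S', y ∈ openCluster (ends '' (↑s : Set ι)) a with hP
  set D : Finset (Finset ι) := E.powerset.filter P with hD
  change 0 ≤ ∑ s ∈ D, T s
  have mem_I : ∀ (W : Set V) (i : ι) (v : V), i ∈ E → v ∈ W → v ∈ ends i → i ∈ I W := by
    intro W i v hiE hv hvi
    simp only [hI, Finset.mem_filter]
    exact ⟨hiE, v, hv, hvi⟩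
  have I_sub : ∀ W : Set V, I W ⊆ E := fun W => Finset.filter_subset _ E
  -- blue clusters are closed under blue edges
  have Q_closed : ∀ (s : Finset ι) {u w : V}, u ∈ Q s → (openGraph (ends '' (↑(E \ s) : Set ι))).Adj u w → w ∈ Q s :=
    fun s u w hu hadj => SimpleGraph.Reachable.trans hu hadj.reachable
  -- split along the fibres of `key`
  rw [← Finset.sum_fiberwise_of_maps_to (s := D) (t := D.image key) (g := key) (fun s hs => Finset.mem_image_of_mem key hs)]
  refine Finset.sum_nonneg fun k hk => ?_
  obtain ⟨s₀, hs₀D, rfl⟩ := Finset.mem_image.mp hk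
  obtain ⟨hs₀E, hPs₀⟩ := Finset.mem_filter.mp hs₀D
  have hs₀E' : s₀ ⊆ E := Finset.mem_powerset.mp hs₀E
  obtain ⟨⟨hyW, hSW⟩, _⟩ := hPs₀
  -- frozen data
  set W₀ : Set V := Q s₀ with hW₀
  set B₀ : Finset ι := I W₀ with hB₀
  set π₀ : Finset ι := s₀ ∩ B₀ with hπ₀
  set Ef : Finset ι := E \ B₀ with hEf
  have hxW : x ∉ W₀ := hSW x hxS
  have hB₀E : B₀ ⊆ E := I_sub W₀
  have hπ₀B₀ : π₀ ⊆ B₀ := Finset.inter_subset_right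
  have hπ₀E : π₀ ⊆ E := hπ₀B₀.trans hB₀E
  have hEfE : Ef ⊆ E := Finset.sdiff_subset
  have hdisj : Disjoint Ef π₀ := by
    rw [hEf]; exact Finset.disjoint_of_subset_right hπ₀B₀ Finset.sdiff_disjoint
  -- (L) locality: a colouring `t ⊆ E` with `t ∩ B₀ = π₀` has the same blue cluster of `q`
  have locality : ∀ t : Finset ι, t ⊆ E → t ∩ B₀ = π₀ → Q t = W₀ := by
    intro t htE ht
    have agree : ∀ i, i ∈ B₀ → (i ∈ E \ t ↔ i ∈ E \ s₀) := by
      intro i hi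
      have h1 : (i ∈ t ↔ i ∈ s₀) := by
        have := congrArg (fun u : Finset ι => i ∈ u) ht
        simp only [hπ₀, Finset.mem_inter, hi, and_true, eq_iff_iff] at this
        exact this
      simp only [Finset.mem_sdiff, hB₀E hi, true_and]
      exact not_congr h1
    have h1 : ∀ u ∈ W₀, ∀ w, (openGraph (ends '' (↑(E \ s₀) : Set ι))).Adj u w →
        (openGraph (ends '' (↑(E \ t) : Set ι))).Adj u w ∧ w ∈ W₀ := by
      intro u hu w hadj
      refine ⟨?_, Q_closed s₀ hu hadj⟩
      rw [openGraph_image_adj] at hadj ⊢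
      obtain ⟨⟨i, his, hi⟩, hne⟩ := hadj
      have hiB : i ∈ B₀ := mem_I W₀ i u (Finset.mem_sdiff.mp his).1 hu (by rw [hi]; exact Sym2.mem_mk_left u w)
      exact ⟨⟨i, (agree i hiB).mpr his, hi⟩, hne⟩
    have h2 : ∀ u ∈ W₀, ∀ w, (openGraph (ends '' (↑(E \ t) : Set ι))).Adj u w →
        (openGraph (ends '' (↑(E \ s₀) : Set ι))).Adj u w ∧ w ∈ W₀ := by
      intro u hu w hadj
      have hadj' : (openGraph (ends '' (↑(E \ s₀) : Set ι))).Adj u w := by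
        rw [openGraph_image_adj] at hadj ⊢
        obtain ⟨⟨i, hit, hi⟩, hne⟩ := hadj
        have hiB : i ∈ B₀ := mem_I W₀ i u (Finset.mem_sdiff.mp hit).1 hu (by rw [hi]; exact Sym2.mem_mk_left u w)
        exact ⟨⟨i, (agree i hiB).mp hit, hi⟩, hne⟩
      exact ⟨hadj', Q_closed s₀ hu hadj'⟩
    have hqW : q ∈ W₀ := mem_openCluster_self _ q
    ext v
    constructor
    · intro hv
      obtain ⟨p⟩ := hv
      exact ((reachable_transfer W₀ h2 p) hqW).2
    · intro hv
      obtain ⟨p⟩ := (show v ∈ Q s₀ from hv)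
      exact ((reachable_transfer W₀ h1 p) hqW).1
  -- the event of the (IG) instance
  set ev : Finset ι → Prop := fun r => ∃ a ∈ S', y ∈ openCluster (ends '' (↑(r ∪ π₀) : Set ι)) a with hev
  -- (F) the fibre of `key s₀` is the image of `{r ⊆ Ef : ev r}` under `r ↦ r ∪ π₀`
  have decomp : ∀ t : Finset ι, t ⊆ E → t ∩ B₀ = π₀ → t = (t \ B₀) ∪ π₀ := by
    intro t _ ht
    rw [← ht]
    ext i
    simp only [Finset.mem_union, Finset.mem_sdiff, Finset.mem_inter]
    tauto
  have fiber_eq : D.filter (fun t => key t = key s₀) = (Ef.powerset.filter ev).image (fun r => r ∪ π₀) := by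
    ext t
    constructor
    · intro ht
      obtain ⟨htD, hkt⟩ := Finset.mem_filter.mp ht
      obtain ⟨htE, hPt⟩ := Finset.mem_filter.mp htD
      have htE' : t ⊆ E := Finset.mem_powerset.mp htE
      have hQt : Q t = W₀ := (Prod.ext_iff.mp hkt).1
      have h2 : t ∩ I (Q t) = s₀ ∩ I (Q s₀) := (Prod.ext_iff.mp hkt).2
      rw [hQt] at h2
      refine Finset.mem_image.mpr ⟨t \ B₀, Finset.mem_filter.mpr ⟨Finset.mem_powerset.mpr (Finset.sdiff_subset_sdiff htE' le_rfl), ?_⟩, (decomp t htE' h2).symm⟩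
      show ∃ a ∈ S', y ∈ openCluster (ends '' (↑((t \ B₀) ∪ π₀) : Set ι)) a
      rw [← decomp t htE' h2]
      exact hPt.2
    · intro ht
      obtain ⟨r, hr, hrt⟩ := Finset.mem_image.mp ht
      obtain ⟨hrEf, hevr⟩ := Finset.mem_filter.mp hr
      have hrEf' : r ⊆ Ef := Finset.mem_powerset.mp hrEf
      subst hrt
      have hrE : r ⊆ E := hrEf'.trans hEfE
      have htE : r ∪ π₀ ⊆ E := Finset.union_subset hrE hπ₀E
      have hrB : r ∩ B₀ = ∅ := by
        rw [← Finset.disjoint_iff_inter_eq_empty]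
        exact Finset.disjoint_of_subset_left hrEf' Finset.sdiff_disjoint
      have htB : (r ∪ π₀) ∩ B₀ = π₀ := by
        rw [Finset.union_inter_distrib_right, hrB, Finset.empty_union, Finset.inter_eq_left.mpr hπ₀B₀]
      have hQt : Q (r ∪ π₀) = W₀ := locality _ htE htB
      refine Finset.mem_filter.mpr ⟨Finset.mem_filter.mpr ⟨Finset.mem_powerset.mpr htE, ?_, hevr⟩, ?_⟩
      · show y ∈ Q (r ∪ π₀) ∧ ∀ a ∈ S, a ∉ Q (r ∪ π₀)
        rw [hQt]; exact ⟨hyW, hSW⟩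
      · show (Q (r ∪ π₀), (r ∪ π₀) ∩ I (Q (r ∪ π₀))) = (Q s₀, s₀ ∩ I (Q s₀))
        rw [hQt]
        exact Prod.ext rfl htB
  rw [fiber_eq, Finset.sum_image]
  swap
  · -- injectivity of `r ↦ r ∪ π₀` on subsets of `Ef`
    intro r₁ hr₁ r₂ hr₂ h
    have h1 : r₁ ⊆ Ef := Finset.mem_powerset.mp (Finset.mem_filter.mp hr₁).1
    have h2 : r₂ ⊆ Ef := Finset.mem_powerset.mp (Finset.mem_filter.mp hr₂).1
    have e1 : (r₁ ∪ π₀) \ B₀ = r₁ := by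
      rw [Finset.union_sdiff_distrib, Finset.sdiff_eq_empty_iff_subset.mpr hπ₀B₀, Finset.union_empty]
      exact Finset.sdiff_eq_self_of_disjoint (Finset.disjoint_of_subset_left h1 Finset.sdiff_disjoint)
    have e2 : (r₂ ∪ π₀) \ B₀ = r₂ := by
      rw [Finset.union_sdiff_distrib, Finset.sdiff_eq_empty_iff_subset.mpr hπ₀B₀, Finset.union_empty]
      exact Finset.sdiff_eq_self_of_disjoint (Finset.disjoint_of_subset_left h2 Finset.sdiff_disjoint)
    have h' : r₁ ∪ π₀ = r₂ ∪ π₀ := h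
    rw [← e1, ← e2, h']
  -- (C) on the fibre the blue cluster of `x` uses no edge at `W₀`
  have blue_eq : ∀ r : Finset ι, r ⊆ Ef → K (E \ (r ∪ π₀)) = K (Ef \ r) := by
    intro r hrEf
    apply Set.Subset.antisymm
    · -- a blue walk from `x ∉ W₀` never meets an edge at `W₀`
      have hrE : r ⊆ E := hrEf.trans hEfE
      have htE : r ∪ π₀ ⊆ E := Finset.union_subset hrE hπ₀E
      have hrB : r ∩ B₀ = ∅ := by
        rw [← Finset.disjoint_iff_inter_eq_empty]
        exact Finset.disjoint_of_subset_left hrEf Finset.sdiff_disjoint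
      have htB : (r ∪ π₀) ∩ B₀ = π₀ := by
        rw [Finset.union_inter_distrib_right, hrB, Finset.empty_union, Finset.inter_eq_left.mpr hπ₀B₀]
      have hQt : Q (r ∪ π₀) = W₀ := locality _ htE htB
      have htr : ∀ u ∈ W₀ᶜ, ∀ w, (openGraph (ends '' (↑(E \ (r ∪ π₀)) : Set ι))).Adj u w →
          (openGraph (ends '' (↑(Ef \ r) : Set ι))).Adj u w ∧ w ∈ W₀ᶜ := by
        intro u hu w hadj
        have hadj0 := hadj
        rw [openGraph_image_adj] at hadj
        obtain ⟨⟨i, hi, hiuw⟩, hne⟩ := hadj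
        obtain ⟨hiE, hit⟩ := Finset.mem_sdiff.mp hi
        have hwW : w ∉ W₀ := by
          intro hw
          have hw' : w ∈ Q (r ∪ π₀) := by rw [hQt]; exact hw
          have hu' : u ∈ Q (r ∪ π₀) := Q_closed (r ∪ π₀) hw' hadj0.symm
          rw [hQt] at hu'
          exact hu hu'
        have hiB : i ∉ B₀ := by
          intro hiB
          have hiB' := hiB
          simp only [hB₀, hI, Finset.mem_filter] at hiB'
          obtain ⟨_, v, hvW, hvi⟩ := hiB'
          rw [hiuw, Sym2.mem_iff] at hvi
          rcases hvi with rfl | rfl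
          · exact hu hvW
          · exact hwW hvW
        refine ⟨?_, hwW⟩
        rw [openGraph_image_adj]
        refine ⟨⟨i, Finset.mem_sdiff.mpr ⟨Finset.mem_sdiff.mpr ⟨hiE, hiB⟩, fun hir => hit (Finset.mem_union_left _ hir)⟩, hiuw⟩, hne⟩
      intro v hv
      obtain ⟨p⟩ := hv
      exact ((reachable_transfer W₀ᶜ htr p) hxW).1
    · refine openCluster_image_mono ends (fun i hi => ?_) x
      obtain ⟨hiEf, hir⟩ := Finset.mem_sdiff.mp hi
      obtain ⟨hiE, hiB⟩ := Finset.mem_sdiff.mp hiEf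
      exact Finset.mem_sdiff.mpr ⟨hiE, fun h => by
        rcases Finset.mem_union.mp h with h | h
        · exact hir h
        · exact hiB (hπ₀B₀ h)⟩
  -- no free edge meets `y ∈ W₀`
  have hyfree : ∀ i ∈ Ef, y ∉ ends i := by
    intro i hi hyi
    obtain ⟨hiE, hiB⟩ := Finset.mem_sdiff.mp hi
    exact hiB (mem_I W₀ i y hiE hyW hyi)
  -- the fibre sum is the (IG) instance with free edges `Ef`, gadget `π₀`
  have key := hIG Ef π₀ hEfE hπ₀E hdisj hyfree
  refine le_trans key (le_of_eq (Finset.sum_congr rfl fun r hr => ?_))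
  have hrEf : r ⊆ Ef := Finset.mem_powerset.mp (Finset.mem_filter.mp hr).1
  simp only [hT]
  rw [blue_eq r hrEf]

end Coefficientwise

end Summit.CriticalPhenomena.PercolationContinuityZ3.Theorems
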